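import Literature.AlgebraicGeometry.Motives.AbelianVarietyEndPointwiseFrobenius
import Literature.AlgebraicGeometry.Motives.IntegralModelTensorReductionMap
import HarnessLib

/-!
# The `q`-Frobenius on geometric points of special fibres: pairs, morphisms, homomorphisms, Galois conjugates
# ([Hartshorne1977] IV Rem. 2.4.1 naturality of Frobenius; [Tate1966Endomorphisms] §1; [SerreTate1968] §1)

Topic `Literature/AlgebraicGeometry/Motives`.  THEOREMS only (no def, no instance, no notation, no named fact, no `sorry`).  Cell
`hodgecm-mathlib` (D-0151), FLOOR 0, programme F0P5a (D9op road 2′, crux item stmt-HodgeConjecture-24832), file (B) «generic scheme glue» of the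
ED. 4 composition of `Cruxes/HLiu418/Lines/F0_D9opRoad2.lean` (F0P5a-p02 (g0) design of record 2026-08-30, planner ED4-CUT-LETTER §8 step 2
«`F`-linearity of `ᾱ`, `𝒯̄ᵢ` on `κ̄`-points» and step 5 «pairs»): every identity below is the naturality of the `q`-Frobenius `F_{X/k}` (★
`frobeniusOver_comp`: `F_X ≫ φ = φ ≫ F_Y` for every `k`-morphism `φ`), read on `L`-valued points.

## What is proved

* §1 (`k` finite, any `k`-algebra field `L`): `F` commutes with every `k`-morphism on points (`map_frobeniusOver_map`); **`F` of a pair is the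
  pair of the `F`'s** — `F_W (⟨a, b⟩ ≫ m) = ⟨F_X a, F_Y b⟩ ≫ m` for any `m : X ⊗ Y ⟶ W` (`map_frobeniusOver_lift_comp`, iterated form
  `iterate_map_frobeniusOver_lift_comp`), in particular for the tensorator `μ` of a monoidal functor into `k`-schemes such as the special-fibre
  functor (`map_frobeniusOver_lift_comp_μ`), and the components of `F z` for `z` a point of `G(A ⊗ B)` (`map_map_fst_frobeniusOver`, `…snd…`).
* §2 (any field `k`): **Galois conjugates of pairs are pairs of conjugates** — `σ • (⟨a, b⟩ ≫ m) = ⟨σ • a, σ • b⟩ ≫ m` (`smul_lift_comp`); the scheme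
  point of a pair is unchanged by conjugating both entries (`pt_lift_smul_comp`), so a pair on a `k`-subscheme (e.g. `∇`) stays on it.
* §3 (abelian varieties over a finite field): `π(P) = F(P)` on `k̄`-points (`geomPointsMap_frobeniusHom_ofMul`); **every homomorphism commutes
  with `π` on `k̄`-points** (`geomPointsMap_geomPointsMap_frobeniusHom`, ★ `frobeniusHom_comp`), iterated forms, and `φ(Fⁿ z) = πⁿ(φ z)` for a
  `k`-morphism `φ : Z ⟶ A` (`ofMul_map_iterate_map_frobeniusOver`, iterating ★ `geomPointsMap_frobeniusHom_ofMul_map`).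
* §4 (special fibres of models at a finite place `v` of a number field, the literal currency of the F0P5a letter
  `RecordCurveEichlerShimuraPointwise`): for an abelian-scheme model `𝒜` (★ `IsAbelianSchemeModel`) and any `𝓞ᵥ`-morphism `𝔞 : 𝒵 ⟶ 𝒜`,
  `𝔞_v(F z) = π(𝔞_v z)`, `𝔞_v(F (F z)) = π(π(𝔞_v z))` and `T̃(𝔞_v(F z)) = π(T̃(𝔞_v z))` for the reduction `T̃ = h.specialFibreHom h T` of an
  endomorphism `T` (ED4 §8 step 2 verbatim: «LHS `= F(𝒯̄₁(ᾱ z))`»); and for proper models `𝒳`, `𝒴`: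
  `Fⁿ(red_{𝒳⊗𝒴}(x₁, x₂)) = (Fⁿ red_𝒳 x₁, Fⁿ red_𝒴 x₂)` (★ `IntegralModel.geomReductionMap_tensor_lift`); §4b additivity bookkeeping
  (ED4 §8 step 5): `red_{⟨𝒜,e⟩} (∏_δ ∏_{i∈s} P δ i) = ∑_δ ∑_{i∈s} red_{⟨𝒜,e⟩} (P δ i)` (★ `integralModel_geomReductionMap_mul` iterated; the shape of
  ★ C1 `comp_nablaTr_comp_α_comp_trace_sum_albTr`).

HC_CM is proved only modulo the 7 printed citations until rung 0 closes; this file is a generic leaf and changes no count.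

## References
* [Hartshorne1977] R. Hartshorne, *Algebraic Geometry*, IV Rem. 2.4.1 (Frobenius commutes with every morphism), II Ex. 4.7.
* [Tate1966Endomorphisms] J. Tate, *Endomorphisms of abelian varieties over finite fields*, Invent. Math. 2 (1966), §1 (`π` is central).
* [SerreTate1968] J.-P. Serre, J. Tate, *Good reduction of abelian varieties*, Ann. of Math. 88 (1968), §1 (the reduction map).
* [GortzWedhorn2020] U. Görtz, T. Wedhorn, *Algebraic Geometry I* (2nd ed.), Section (4.7) (fibre products, points of products).
-/

set_option autoImplicit false

noncomputable section

universe u v₁ u₁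

open CategoryTheory CategoryTheory.Limits MonoidalCategory CartesianMonoidalCategory

namespace Literature.AlgebraicGeometry.Motives

/-! ### §1 The `q`-Frobenius on points: morphisms and pairs -/

namespace AlgPoints

section Frobenius

variable {k : Type u} [Field k] [Finite k] {X Y W : SchemeOver k} {L : Type u} [Field L] [Algebra k L]

/-- **`F` commutes with every `k`-morphism on points**: `F_Y(φ P) = φ(F_X P)` ([Hartshorne1977] IV Rem. 2.4.1; ★ `frobeniusOver_comp`).
[cite: Hartshorne1977, IV Rem. 2.4.1] -/
theorem map_frobeniusOver_map (φ : X ⟶ Y) (P : AlgPoints X L) :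
    map (frobeniusOver Y) (map φ P) = map φ (map (frobeniusOver X) P) := by
  rw [map_apply, map_apply, map_apply, map_apply, Category.assoc, Category.assoc, frobeniusOver_comp φ]

/-- Iterated form: `F_Yⁿ(φ P) = φ(F_Xⁿ P)`. [cite: Hartshorne1977, IV Rem. 2.4.1] -/
theorem iterate_map_frobeniusOver_map (φ : X ⟶ Y) (n : ℕ) (P : AlgPoints X L) :
    (map (frobeniusOver Y))^[n] (map φ P) = map φ ((map (frobeniusOver X))^[n] P) := by
  induction n with
  | zero => rfl
  | succ n ih => rw [Function.iterate_succ_apply', Function.iterate_succ_apply', ih, map_frobeniusOver_map]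

/-- **`F` of a pair is the pair of the `F`'s, through any morphism out of the product**: for `a : T ⟶ X`, `b : T ⟶ Y` over `k` and
`m : X ⊗ Y ⟶ W`, `(⟨a, b⟩ ≫ m) ≫ F_W = ⟨a ≫ F_X, b ≫ F_Y⟩ ≫ m` (`F_{X ⊗ Y} = F_X ⊗ F_Y`, ★ `AbelianVariety.frobeniusOver_tensorObj`, and naturality ★
`frobeniusOver_comp m`). [cite: Hartshorne1977, IV Rem. 2.4.1] [cite: GortzWedhorn2020, Section (4.7)] -/
theorem lift_comp_comp_frobeniusOver {T : SchemeOver k} (a : T ⟶ X) (b : T ⟶ Y) (m : X ⊗ Y ⟶ W) :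
    (lift a b ≫ m) ≫ frobeniusOver W = lift (a ≫ frobeniusOver X) (b ≫ frobeniusOver Y) ≫ m := by
  rw [Category.assoc, ← frobeniusOver_comp m, ← Category.assoc, AbelianVariety.frobeniusOver_tensorObj, lift_map]

/-- **`F` of a pair of points is the pair of the `F`'s**: `F_{X⊗Y} ⟨a, b⟩ = ⟨F_X a, F_Y b⟩` on `L`-points.
[cite: Hartshorne1977, IV Rem. 2.4.1] [cite: GortzWedhorn2020, Section (4.7)] -/
theorem map_frobeniusOver_lift (a : AlgPoints X L) (b : AlgPoints Y L) :
    map (frobeniusOver (X ⊗ Y)) (lift a b) = lift (map (frobeniusOver X) a) (map (frobeniusOver Y) b) := by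
  rw [map_apply, map_apply, map_apply, AbelianVariety.frobeniusOver_tensorObj, lift_map]

/-- The same through any morphism `m : X ⊗ Y ⟶ W` out of the product: `F_W (⟨a, b⟩ ≫ m) = ⟨F_X a, F_Y b⟩ ≫ m` on `L`-points.
[cite: Hartshorne1977, IV Rem. 2.4.1] [cite: GortzWedhorn2020, Section (4.7)] -/
theorem map_frobeniusOver_lift_comp (a : AlgPoints X L) (b : AlgPoints Y L) (m : X ⊗ Y ⟶ W) :
    map (frobeniusOver W) (lift a b ≫ m) = lift (map (frobeniusOver X) a) (map (frobeniusOver Y) b) ≫ m := by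
  rw [map_apply, map_apply, map_apply, lift_comp_comp_frobeniusOver]

/-- Iterated form: `F_Wⁿ (⟨a, b⟩ ≫ m) = ⟨F_Xⁿ a, F_Yⁿ b⟩ ≫ m` (e.g. `n = 2` for the middle term `ᾱ(F² z)` of the F0P5a letter).
[cite: Hartshorne1977, IV Rem. 2.4.1] [cite: GortzWedhorn2020, Section (4.7)] -/
theorem iterate_map_frobeniusOver_lift_comp (a : AlgPoints X L) (b : AlgPoints Y L) (m : X ⊗ Y ⟶ W) (n : ℕ) :
    (map (frobeniusOver W))^[n] (lift a b ≫ m) = lift ((map (frobeniusOver X))^[n] a) ((map (frobeniusOver Y))^[n] b) ≫ m := by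
  induction n with
  | zero => rfl
  | succ n ih => rw [Function.iterate_succ_apply', Function.iterate_succ_apply', Function.iterate_succ_apply', ih, map_frobeniusOver_lift_comp]

variable {C : Type u₁} [Category.{v₁} C] [CartesianMonoidalCategory C] (G : C ⥤ SchemeOver k) {A B : C}

/-- **First component of `F z`** for a point `z` of `G(A ⊗ B)`: `(F z) ≫ G(fst) = F (z ≫ G(fst))`.
[cite: Hartshorne1977, IV Rem. 2.4.1] [cite: GortzWedhorn2020, Section (4.7)] -/
theorem map_map_fst_frobeniusOver (z : AlgPoints (G.obj (A ⊗ B)) L) :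
    map (G.map (fst A B)) (map (frobeniusOver (G.obj (A ⊗ B))) z) = map (frobeniusOver (G.obj A)) (map (G.map (fst A B)) z) :=
  (map_frobeniusOver_map (G.map (fst A B)) z).symm

/-- **Second component of `F z`** for a point `z` of `G(A ⊗ B)`: `(F z) ≫ G(snd) = F (z ≫ G(snd))`.
[cite: Hartshorne1977, IV Rem. 2.4.1] [cite: GortzWedhorn2020, Section (4.7)] -/
theorem map_map_snd_frobeniusOver (z : AlgPoints (G.obj (A ⊗ B)) L) :
    map (G.map (snd A B)) (map (frobeniusOver (G.obj (A ⊗ B))) z) = map (frobeniusOver (G.obj B)) (map (G.map (snd A B)) z) :=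
  (map_frobeniusOver_map (G.map (snd A B)) z).symm

variable [G.Monoidal]

/-- **Pairs through the tensorator of a monoidal functor into `k`-schemes** (e.g. the special-fibre functor `𝒳 ↦ 𝒳 ×_{𝓞ᵥ} κ(v)`, whose
`L`-points of `G(A ⊗ B)` are the pairs `⟨a, b⟩ ≫ μ_G`, ★ `CartesianMonoidal.eq_lift_comp_μ`): `F_{G(A⊗B)} (⟨a, b⟩ ≫ μ) = ⟨F a, F b⟩ ≫ μ`.
[cite: Hartshorne1977, IV Rem. 2.4.1] [cite: GortzWedhorn2020, Section (4.7)] -/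
theorem map_frobeniusOver_lift_comp_μ (a : AlgPoints (G.obj A) L) (b : AlgPoints (G.obj B) L) :
    map (frobeniusOver (G.obj (A ⊗ B))) (lift a b ≫ Functor.LaxMonoidal.μ G A B) =
      lift (map (frobeniusOver (G.obj A)) a) (map (frobeniusOver (G.obj B)) b) ≫ Functor.LaxMonoidal.μ G A B :=
  map_frobeniusOver_lift_comp a b _

/-- Iterated form through the tensorator: `Fⁿ (⟨a, b⟩ ≫ μ) = ⟨Fⁿ a, Fⁿ b⟩ ≫ μ`. [cite: Hartshorne1977, IV Rem. 2.4.1] [cite: GortzWedhorn2020, Section (4.7)] -/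
theorem iterate_map_frobeniusOver_lift_comp_μ (a : AlgPoints (G.obj A) L) (b : AlgPoints (G.obj B) L) (n : ℕ) :
    (map (frobeniusOver (G.obj (A ⊗ B))))^[n] (lift a b ≫ Functor.LaxMonoidal.μ G A B) =
      lift ((map (frobeniusOver (G.obj A)))^[n] a) ((map (frobeniusOver (G.obj B)))^[n] b) ≫ Functor.LaxMonoidal.μ G A B :=
  iterate_map_frobeniusOver_lift_comp a b _ n

end Frobenius

/-! ### §2 Galois conjugates of pairs -/

section Galois

variable {k : Type u} [Field k] {X Y W : SchemeOver k} {L : Type u} [Field L] [Algebra k L]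

/-- **The conjugate of a pair is the pair of the conjugates**: `σ • ⟨a, b⟩ = ⟨σ • a, σ • b⟩` for `σ ∈ Aut(L/k)` (the action is
`σ • P = Spec σ ≫ P`, ★ `AlgPoints.smul_def`). [cite: Hartshorne1977, II Ex. 4.7] [cite: GortzWedhorn2020, Section (4.7)] -/
theorem smul_lift (σ : L ≃ₐ[k] L) (a : AlgPoints X L) (b : AlgPoints Y L) :
    σ • (lift a b : AlgPoints (X ⊗ Y) L) = lift (σ • a) (σ • b) := by
  rw [smul_def, smul_def, smul_def, comp_lift]

/-- The same through any morphism `m : X ⊗ Y ⟶ W` out of the product: `σ • (⟨a, b⟩ ≫ m) = ⟨σ • a, σ • b⟩ ≫ m`.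
[cite: Hartshorne1977, II Ex. 4.7] [cite: GortzWedhorn2020, Section (4.7)] -/
theorem smul_lift_comp (σ : L ≃ₐ[k] L) (a : AlgPoints X L) (b : AlgPoints Y L) (m : X ⊗ Y ⟶ W) :
    σ • (lift a b ≫ m : AlgPoints W L) = lift (σ • a) (σ • b) ≫ m := by
  rw [smul_def, smul_def, smul_def, ← Category.assoc, comp_lift]

/-- **Conjugating both entries of a pair does not move its underlying scheme point** (★ `AlgPoints.pt_smul`): so if `⟨a, b⟩ ≫ m` lies on a
`k`-subscheme of `W` (a condition on `pt`, e.g. «same connected component», the locus `∇`), so does `⟨σ • a, σ • b⟩ ≫ m`.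
[cite: Hartshorne1977, II Ex. 4.7] -/
theorem pt_lift_smul_comp (σ : L ≃ₐ[k] L) (a : AlgPoints X L) (b : AlgPoints Y L) (m : X ⊗ Y ⟶ W) :
    pt (lift (σ • a) (σ • b) ≫ m : AlgPoints W L) = pt (lift a b ≫ m : AlgPoints W L) := by
  rw [← smul_lift_comp, pt_smul]

/-- **A pair that factors through a `k`-morphism `ι : N ⟶ W` still factors after conjugation**: from `Q ≫ ι = ⟨a, b⟩ ≫ m` get
`(σ • Q) ≫ ι = ⟨σ • a, σ • b⟩ ≫ m` (★ `AlgPoints.map_smul`; used with `ι` the inclusion of the same-component locus `∇ ↪ X ⊗ X`).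
[cite: Hartshorne1977, II Ex. 4.7] -/
theorem exists_comp_eq_lift_smul_comp {N : SchemeOver k} (ι : N ⟶ W) (σ : L ≃ₐ[k] L) (a : AlgPoints X L) (b : AlgPoints Y L)
    (m : X ⊗ Y ⟶ W) (h : ∃ Q : AlgPoints N L, Q ≫ ι = lift a b ≫ m) :
    ∃ Q : AlgPoints N L, Q ≫ ι = lift (σ • a) (σ • b) ≫ m := by
  obtain ⟨Q, hQ⟩ := h
  refine ⟨σ • Q, ?_⟩
  rw [← smul_lift_comp, ← map_apply, map_smul, map_apply, hQ]

end Galois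

end AlgPoints

/-! ### §3 Abelian varieties over a finite field: `π` on `k̄`-points -/

namespace AbelianVariety

variable {k : Type u} [Field k] [Finite k] {A B : AbelianVariety k} {Z : SchemeOver k}

/-- **`π(P) = F(P)` on `k̄`-points**: the Frobenius endomorphism `π = frobeniusHom A` acts on `A(k̄)` as the `q`-Frobenius `F_{A/k}` of the
`k`-scheme `A` (★ `frobeniusHom_hom_hom_hom`). [cite: Tate1966Endomorphisms, §1] -/
theorem geomPointsMap_frobeniusHom_ofMul (P : A.Points (AlgebraicClosure k)) :
    Hom.geomPointsMap (frobeniusHom A) (Additive.ofMul P) = Additive.ofMul (AlgPoints.map (frobeniusOver A.X) P) := by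
  rw [Hom.geomPointsMap_ofMul, frobeniusHom_hom_hom_hom]

/-- **Every homomorphism commutes with `π` on `k̄`-points**: `f(π P) = π(f P)` for `f : A ⟶ B` ([Tate1966Endomorphisms] §1: `π` commutes with
every homomorphism, ★ `frobeniusHom_comp`; in particular the reductions `𝒯̄ᵢ` of the F0P5a letter are `π`-linear). [cite: Tate1966Endomorphisms, §1] -/
theorem geomPointsMap_geomPointsMap_frobeniusHom (f : A ⟶ B) (x : A.geomPoints) :
    Hom.geomPointsMap f (Hom.geomPointsMap (frobeniusHom A) x) = Hom.geomPointsMap (frobeniusHom B) (Hom.geomPointsMap f x) := by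
  rw [← AddMonoidHom.comp_apply, ← Hom.geomPointsMap_comp, frobeniusHom_comp, Hom.geomPointsMap_comp, AddMonoidHom.comp_apply]

/-- Iterated form: `f(πⁿ P) = πⁿ(f P)`. [cite: Tate1966Endomorphisms, §1] -/
theorem geomPointsMap_iterate_geomPointsMap_frobeniusHom (f : A ⟶ B) (n : ℕ) (x : A.geomPoints) :
    Hom.geomPointsMap f ((Hom.geomPointsMap (frobeniusHom A))^[n] x) = (Hom.geomPointsMap (frobeniusHom B))^[n] (Hom.geomPointsMap f x) := by
  induction n with
  | zero => rfl
  | succ n ih => rw [Function.iterate_succ_apply', Function.iterate_succ_apply', geomPointsMap_geomPointsMap_frobeniusHom, ih]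

/-- **`φ(Fⁿ z) = πⁿ(φ z)`** on `k̄`-points for a `k`-morphism `φ : Z ⟶ A` (iterating ★ `geomPointsMap_frobeniusHom_ofMul_map`; `n = 1, 2` are the
two `F`-twisted terms `ᾱ(F z)`, `ᾱ(F² z)` of the F0P5a letter with `φ := 𝔞_v`). [cite: Tate1966Endomorphisms, §1] -/
theorem ofMul_map_iterate_map_frobeniusOver (φ : Z ⟶ A.X) (n : ℕ) (z : AlgPoints Z (AlgebraicClosure k)) :
    Additive.ofMul (AlgPoints.map φ ((AlgPoints.map (frobeniusOver Z))^[n] z)) =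
      (Hom.geomPointsMap (frobeniusHom A))^[n] (Additive.ofMul (AlgPoints.map φ z)) := by
  induction n with
  | zero => rfl
  | succ n ih => rw [Function.iterate_succ_apply', Function.iterate_succ_apply', ← ih, geomPointsMap_frobeniusHom_ofMul_map]

/-- `φ(F z) = π(φ z)` (★ `geomPointsMap_frobeniusHom_ofMul_map` read from the twisted side). [cite: Tate1966Endomorphisms, §1] -/
theorem ofMul_map_map_frobeniusOver (φ : Z ⟶ A.X) (z : AlgPoints Z (AlgebraicClosure k)) :
    Additive.ofMul (AlgPoints.map φ (AlgPoints.map (frobeniusOver Z) z)) = Hom.geomPointsMap (frobeniusHom A) (Additive.ofMul (AlgPoints.map φ z)) :=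
  (geomPointsMap_frobeniusHom_ofMul_map φ z).symm

/-- `φ(F (F z)) = π(π(φ z))`. [cite: Tate1966Endomorphisms, §1] -/
theorem ofMul_map_map_map_frobeniusOver (φ : Z ⟶ A.X) (z : AlgPoints Z (AlgebraicClosure k)) :
    Additive.ofMul (AlgPoints.map φ (AlgPoints.map (frobeniusOver Z) (AlgPoints.map (frobeniusOver Z) z))) =
      Hom.geomPointsMap (frobeniusHom A) (Hom.geomPointsMap (frobeniusHom A) (Additive.ofMul (AlgPoints.map φ z))) := by
  rw [ofMul_map_map_frobeniusOver, ofMul_map_map_frobeniusOver]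

/-- **`T(φ(F z)) = π(T(φ z))`** for a homomorphism `T : A ⟶ B` and a `k`-morphism `φ : Z ⟶ A` — ED4 §8 step 2 verbatim («LHS `= F(𝒯̄₁(ᾱ z))`»).
[cite: Tate1966Endomorphisms, §1] -/
theorem geomPointsMap_ofMul_map_map_frobeniusOver (T : A ⟶ B) (φ : Z ⟶ A.X) (z : AlgPoints Z (AlgebraicClosure k)) :
    Hom.geomPointsMap T (Additive.ofMul (AlgPoints.map φ (AlgPoints.map (frobeniusOver Z) z))) =
      Hom.geomPointsMap (frobeniusHom B) (Hom.geomPointsMap T (Additive.ofMul (AlgPoints.map φ z))) := by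
  rw [ofMul_map_map_frobeniusOver, geomPointsMap_geomPointsMap_frobeniusHom]

/-- `T(φ(F (F z))) = π(π(T(φ z)))`. [cite: Tate1966Endomorphisms, §1] -/
theorem geomPointsMap_ofMul_map_map_map_frobeniusOver (T : A ⟶ B) (φ : Z ⟶ A.X) (z : AlgPoints Z (AlgebraicClosure k)) :
    Hom.geomPointsMap T (Additive.ofMul (AlgPoints.map φ (AlgPoints.map (frobeniusOver Z) (AlgPoints.map (frobeniusOver Z) z)))) =
      Hom.geomPointsMap (frobeniusHom B) (Hom.geomPointsMap (frobeniusHom B) (Hom.geomPointsMap T (Additive.ofMul (AlgPoints.map φ z)))) := by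
  rw [ofMul_map_map_map_frobeniusOver, geomPointsMap_geomPointsMap_frobeniusHom, geomPointsMap_geomPointsMap_frobeniusHom]

end AbelianVariety

end Literature.AlgebraicGeometry.Motives

/-! ### §4 Special fibres of models at a finite place (the currency of the F0P5a letter) -/

namespace Literature.NumberTheory.DiophantineGeometry.IsAbelianSchemeModel

open _root_.AlgebraicGeometry IsDedekindDomain IsDedekindDomain.HeightOneSpectrum
open scoped NumberField MonObj CategoryTheory.Obj
open Literature.AlgebraicGeometry.Motives Literature.AlgebraicGeometry.Motives.AbelianVariety

variable {K : Type} [Field K] [NumberField K] {v : HeightOneSpectrum (𝓞 K)} {B : AbelianVariety K}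
  {𝒜 : SchemeOver (valuationSubringAtPrime K v)} [GrpObj 𝒜] {𝒵 : SchemeOver (valuationSubringAtPrime K v)}

/-- **`𝔞_v(F z) = π(𝔞_v z)`** in `𝒜_v(κ̄(v))`: for an abelian-scheme model `𝒜` of `B` at `v`, an `𝓞ᵥ`-morphism `𝔞 : 𝒵 ⟶ 𝒜` and a `κ̄(v)`-point `z`
of the special fibre `𝒵_v`, the special fibre `𝔞_v` carries `F z` to the Frobenius endomorphism `π` of the abelian variety `𝒜_v` applied to
`𝔞_v z` (★ `geomPointsMap_frobeniusHom_ofMul_map` at `φ := 𝔞_v`; the F0P5a letter's `ᾱ(F z)`). [cite: Tate1966Endomorphisms, §1] [cite: SerreTate1968, §1] -/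
theorem ofMul_map_specialFibreFunctor_map_frobeniusOver (h : IsAbelianSchemeModel B v 𝒜) (𝔞 : 𝒵 ⟶ 𝒜)
    (z : AlgPoints ((specialFibreFunctor v).obj 𝒵) (geomResidueField v)) :
    (Additive.ofMul (AlgPoints.map ((specialFibreFunctor v).map 𝔞) (AlgPoints.map (frobeniusOver _) z)) : h.specialFibre.geomPoints) =
      Hom.geomPointsMap (frobeniusHom h.specialFibre) (Additive.ofMul (AlgPoints.map ((specialFibreFunctor v).map 𝔞) z)) :=
  ofMul_map_map_frobeniusOver (A := h.specialFibre) ((specialFibreFunctor v).map 𝔞) z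

/-- `𝔞_v(F (F z)) = π(π(𝔞_v z))` (the letter's middle term `ᾱ(F² z)`). [cite: Tate1966Endomorphisms, §1] [cite: SerreTate1968, §1] -/
theorem ofMul_map_specialFibreFunctor_map_frobeniusOver_frobeniusOver (h : IsAbelianSchemeModel B v 𝒜) (𝔞 : 𝒵 ⟶ 𝒜)
    (z : AlgPoints ((specialFibreFunctor v).obj 𝒵) (geomResidueField v)) :
    (Additive.ofMul (AlgPoints.map ((specialFibreFunctor v).map 𝔞)
        (AlgPoints.map (frobeniusOver _) (AlgPoints.map (frobeniusOver _) z))) : h.specialFibre.geomPoints) =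
      Hom.geomPointsMap (frobeniusHom h.specialFibre)
        (Hom.geomPointsMap (frobeniusHom h.specialFibre) (Additive.ofMul (AlgPoints.map ((specialFibreFunctor v).map 𝔞) z))) :=
  ofMul_map_map_map_frobeniusOver (A := h.specialFibre) ((specialFibreFunctor v).map 𝔞) z

variable {A : AbelianVariety K} {ℬ : SchemeOver (valuationSubringAtPrime K v)} [GrpObj ℬ]

/-- **`T̃(𝔞_v(F z)) = π(T̃(𝔞_v z))`** for the reduction `T̃ = h.specialFibreHom h' T` of a homomorphism `T : B ⟶ A` between abelian varieties with
abelian-scheme models `𝒜`, `ℬ` at `v` — ED4 §8 step 2 «LHS `= F(𝒯̄₁(ᾱ z))`» in the letter's literal currency. [cite: Tate1966Endomorphisms, §1]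
[cite: SerreTate1968, §1] -/
theorem geomPointsMap_specialFibreHom_ofMul_map_frobeniusOver (h : IsAbelianSchemeModel B v 𝒜) (h' : IsAbelianSchemeModel A v ℬ) (T : B ⟶ A)
    (𝔞 : 𝒵 ⟶ 𝒜) (z : AlgPoints ((specialFibreFunctor v).obj 𝒵) (geomResidueField v)) :
    Hom.geomPointsMap (h.specialFibreHom h' T)
        (Additive.ofMul (AlgPoints.map ((specialFibreFunctor v).map 𝔞) (AlgPoints.map (frobeniusOver _) z))) =
      Hom.geomPointsMap (frobeniusHom h'.specialFibre)
        (Hom.geomPointsMap (h.specialFibreHom h' T) (Additive.ofMul (AlgPoints.map ((specialFibreFunctor v).map 𝔞) z))) :=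
  geomPointsMap_ofMul_map_map_frobeniusOver (A := h.specialFibre) (B := h'.specialFibre) (h.specialFibreHom h' T) ((specialFibreFunctor v).map 𝔞) z

/-- `T̃(𝔞_v(F (F z))) = π(π(T̃(𝔞_v z)))`. [cite: Tate1966Endomorphisms, §1] [cite: SerreTate1968, §1] -/
theorem geomPointsMap_specialFibreHom_ofMul_map_frobeniusOver_frobeniusOver (h : IsAbelianSchemeModel B v 𝒜) (h' : IsAbelianSchemeModel A v ℬ)
    (T : B ⟶ A) (𝔞 : 𝒵 ⟶ 𝒜) (z : AlgPoints ((specialFibreFunctor v).obj 𝒵) (geomResidueField v)) :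
    Hom.geomPointsMap (h.specialFibreHom h' T)
        (Additive.ofMul (AlgPoints.map ((specialFibreFunctor v).map 𝔞)
          (AlgPoints.map (frobeniusOver _) (AlgPoints.map (frobeniusOver _) z)))) =
      Hom.geomPointsMap (frobeniusHom h'.specialFibre) (Hom.geomPointsMap (frobeniusHom h'.specialFibre)
        (Hom.geomPointsMap (h.specialFibreHom h' T) (Additive.ofMul (AlgPoints.map ((specialFibreFunctor v).map 𝔞) z)))) :=
  geomPointsMap_ofMul_map_map_map_frobeniusOver (A := h.specialFibre) (B := h'.specialFibre) (h.specialFibreHom h' T)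
    ((specialFibreFunctor v).map 𝔞) z

/-- The reduction `T̃` of an endomorphism commutes with `π` on `κ̄(v)`-points: `T̃(π x) = π(T̃ x)` (`𝒯̄ᵢ ∘ F = F ∘ 𝒯̄ᵢ`, ED4 §8 step 2).
[cite: Tate1966Endomorphisms, §1] -/
theorem geomPointsMap_specialFibreHom_geomPointsMap_frobeniusHom (h : IsAbelianSchemeModel B v 𝒜) (h' : IsAbelianSchemeModel A v ℬ) (T : B ⟶ A)
    (x : h.specialFibre.geomPoints) :
    Hom.geomPointsMap (h.specialFibreHom h' T) (Hom.geomPointsMap (frobeniusHom h.specialFibre) x) =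
      Hom.geomPointsMap (frobeniusHom h'.specialFibre) (Hom.geomPointsMap (h.specialFibreHom h' T) x) :=
  geomPointsMap_geomPointsMap_frobeniusHom (h.specialFibreHom h' T) x

/-! #### §4b Additivity bookkeeping: the reduction of a finite product of points (ED4 §8 step 5) -/

/-- **`red_{⟨𝒜, e⟩} (∏_{i ∈ s} Pᵢ) = ∑_{i ∈ s} red_{⟨𝒜, e⟩} Pᵢ`** (additively written in `𝒜_v(κ̄(v))`): the group-free reduction map of the model
of an abelian scheme is a homomorphism on `Ω`-points (★ `integralModel_geomReductionMap_mul`, ★ `…_one`; [SerreTate1968] §1 «the reduction map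
is a homomorphism»), iterated over a `Finset` — the shape of ★ C1 `comp_nablaTr_comp_α_comp_trace_sum_albTr` (`∏_δ ∏_{i ∈ s}` of points).
[cite: SerreTate1968, §1] -/
theorem integralModel_geomReductionMap_finsetProd (h : IsAbelianSchemeModel B v 𝒜) {J : Type*} (s : Finset J)
    (P : J → B.Points (AlgebraicClosure (v.adicCompletion K))) :
    (Additive.ofMul (haveI := h.isProper
      (⟨𝒜, h.exists_iso.choose⟩ : IntegralModel (valuationSubringAtPrime K v) K B.X).geomReductionMap (∏ i ∈ s, P i)) :
        h.specialFibre.geomPoints) =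
      ∑ i ∈ s, (Additive.ofMul (haveI := h.isProper
        (⟨𝒜, h.exists_iso.choose⟩ : IntegralModel (valuationSubringAtPrime K v) K B.X).geomReductionMap (P i)) :
          h.specialFibre.geomPoints) := by
  classical
  induction s using Finset.induction_on with
  | empty => rw [Finset.prod_empty, Finset.sum_empty, h.integralModel_geomReductionMap_one]
  | insert i s hi ih => rw [Finset.prod_insert hi, Finset.sum_insert hi, h.integralModel_geomReductionMap_mul, ih]

/-- `red_{⟨𝒜, e⟩} (∏ᵢ Pᵢ) = ∑ᵢ red_{⟨𝒜, e⟩} Pᵢ` over a `Fintype`. [cite: SerreTate1968, §1] -/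
theorem integralModel_geomReductionMap_prod (h : IsAbelianSchemeModel B v 𝒜) {J : Type*} [Fintype J]
    (P : J → B.Points (AlgebraicClosure (v.adicCompletion K))) :
    (Additive.ofMul (haveI := h.isProper
      (⟨𝒜, h.exists_iso.choose⟩ : IntegralModel (valuationSubringAtPrime K v) K B.X).geomReductionMap (∏ i, P i)) :
        h.specialFibre.geomPoints) =
      ∑ i, (Additive.ofMul (haveI := h.isProper
        (⟨𝒜, h.exists_iso.choose⟩ : IntegralModel (valuationSubringAtPrime K v) K B.X).geomReductionMap (P i)) :
          h.specialFibre.geomPoints) :=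
  h.integralModel_geomReductionMap_finsetProd Finset.univ P

/-- Double form `red (∏_δ ∏_{i ∈ s} P δ i) = ∑_δ ∑_{i ∈ s} red (P δ i)` (the exact shape of ★ C1's right-hand side). [cite: SerreTate1968, §1] -/
theorem integralModel_geomReductionMap_prod_finsetProd (h : IsAbelianSchemeModel B v 𝒜) {Δ J : Type*} [Fintype Δ] (s : Finset J)
    (P : Δ → J → B.Points (AlgebraicClosure (v.adicCompletion K))) :
    (Additive.ofMul (haveI := h.isProper
      (⟨𝒜, h.exists_iso.choose⟩ : IntegralModel (valuationSubringAtPrime K v) K B.X).geomReductionMap (∏ δ, ∏ i ∈ s, P δ i)) :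
        h.specialFibre.geomPoints) =
      ∑ δ, ∑ i ∈ s, (Additive.ofMul (haveI := h.isProper
        (⟨𝒜, h.exists_iso.choose⟩ : IntegralModel (valuationSubringAtPrime K v) K B.X).geomReductionMap (P δ i)) :
          h.specialFibre.geomPoints) := by
  rw [h.integralModel_geomReductionMap_prod]
  exact Finset.sum_congr rfl fun δ _ => h.integralModel_geomReductionMap_finsetProd s (P δ)

end Literature.NumberTheory.DiophantineGeometry.IsAbelianSchemeModel

namespace Literature.AlgebraicGeometry.Motives.IntegralModel

open _root_.AlgebraicGeometry IsDedekindDomain IsDedekindDomain.HeightOneSpectrum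
open scoped NumberField
open Literature.NumberTheory.DiophantineGeometry

variable {K : Type} [Field K] [NumberField K] {v : HeightOneSpectrum (𝓞 K)} {X Y : SchemeOver K}

/-- **`F` on a pair of special-fibre points is the pair of the `F`'s**, for the special-fibre functor at `v`:
`F_{(𝒳⊗𝒴)_v} (⟨a, b⟩ ≫ μ_v) = ⟨F_{𝒳_v} a, F_{𝒴_v} b⟩ ≫ μ_v` (§1 at `G := specialFibreFunctor v`). [cite: Hartshorne1977, IV Rem. 2.4.1]
[cite: GortzWedhorn2020, Section (4.7)] -/
theorem map_frobeniusOver_lift_comp_μ_specialFibreFunctor (𝒳 𝒴 : SchemeOver (valuationSubringAtPrime K v))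
    (a : AlgPoints ((specialFibreFunctor v).obj 𝒳) (geomResidueField v)) (b : AlgPoints ((specialFibreFunctor v).obj 𝒴) (geomResidueField v)) :
    AlgPoints.map (frobeniusOver ((specialFibreFunctor v).obj (𝒳 ⊗ 𝒴))) (lift a b ≫ Functor.LaxMonoidal.μ (specialFibreFunctor v) 𝒳 𝒴) =
      lift (AlgPoints.map (frobeniusOver _) a) (AlgPoints.map (frobeniusOver _) b) ≫ Functor.LaxMonoidal.μ (specialFibreFunctor v) 𝒳 𝒴 :=
  AlgPoints.map_frobeniusOver_lift_comp_μ (specialFibreFunctor v) a b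

/-- **`Fⁿ(red_{𝒳⊗𝒴}(x₁, x₂)) = (Fⁿ red_𝒳 x₁, Fⁿ red_𝒴 x₂)`** for PROPER integral models `𝒳`, `𝒴` at `v` and `Ω`-points `x₁ ∈ X(Ω)`, `x₂ ∈ Y(Ω)`
(★ `geomReductionMap_tensor_lift` «the reduction of a pair is the pair of reductions», then §1): the `F`-twists of a reduced pair are computed
entry-wise (ED4 §8 step 5, the points `a_{k,α} = F red_𝒮(…)`, `b_{k,α} = F red_𝒮(…)` paired in `(𝒮 ⊗ 𝒮)_w`). [cite: SerreTate1968, §1]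
[cite: Hartshorne1977, IV Rem. 2.4.1] [cite: GortzWedhorn2020, Section (4.7)] -/
theorem iterate_map_frobeniusOver_geomReductionMap_tensor_lift (𝒳 : IntegralModel (valuationSubringAtPrime K v) K X)
    (𝒴 : IntegralModel (valuationSubringAtPrime K v) K Y) [IsProper 𝒳.total.hom] [IsProper 𝒴.total.hom]
    (x₁ : AlgPoints X (AlgebraicClosure (v.adicCompletion K))) (x₂ : AlgPoints Y (AlgebraicClosure (v.adicCompletion K))) (n : ℕ) :
    (AlgPoints.map (frobeniusOver ((specialFibreFunctor v).obj (𝒳.total ⊗ 𝒴.total))))^[n]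
        (haveI := isProper_tensor_total 𝒳 𝒴; (𝒳.tensor 𝒴).geomReductionMap (lift x₁ x₂)) =
      lift ((AlgPoints.map (frobeniusOver 𝒳.reductionAt))^[n] (𝒳.geomReductionMap x₁))
          ((AlgPoints.map (frobeniusOver 𝒴.reductionAt))^[n] (𝒴.geomReductionMap x₂)) ≫
        Functor.LaxMonoidal.μ (specialFibreFunctor v) 𝒳.total 𝒴.total := by
  rw [geomReductionMap_tensor_lift]
  exact AlgPoints.iterate_map_frobeniusOver_lift_comp_μ (specialFibreFunctor v) _ _ n

/-- `n = 1`: `F(red_{𝒳⊗𝒴}(x₁, x₂)) = (F red_𝒳 x₁, F red_𝒴 x₂)`. [cite: SerreTate1968, §1] [cite: Hartshorne1977, IV Rem. 2.4.1] -/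
theorem map_frobeniusOver_geomReductionMap_tensor_lift (𝒳 : IntegralModel (valuationSubringAtPrime K v) K X)
    (𝒴 : IntegralModel (valuationSubringAtPrime K v) K Y) [IsProper 𝒳.total.hom] [IsProper 𝒴.total.hom]
    (x₁ : AlgPoints X (AlgebraicClosure (v.adicCompletion K))) (x₂ : AlgPoints Y (AlgebraicClosure (v.adicCompletion K))) :
    AlgPoints.map (frobeniusOver ((specialFibreFunctor v).obj (𝒳.total ⊗ 𝒴.total)))
        (haveI := isProper_tensor_total 𝒳 𝒴; (𝒳.tensor 𝒴).geomReductionMap (lift x₁ x₂)) =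
      lift (AlgPoints.map (frobeniusOver 𝒳.reductionAt) (𝒳.geomReductionMap x₁))
          (AlgPoints.map (frobeniusOver 𝒴.reductionAt) (𝒴.geomReductionMap x₂)) ≫
        Functor.LaxMonoidal.μ (specialFibreFunctor v) 𝒳.total 𝒴.total :=
  iterate_map_frobeniusOver_geomReductionMap_tensor_lift 𝒳 𝒴 x₁ x₂ 1

/-- `n = 2`: `F(F(red_{𝒳⊗𝒴}(x₁, x₂))) = (F (F red_𝒳 x₁), F (F red_𝒴 x₂))`. [cite: SerreTate1968, §1] [cite: Hartshorne1977, IV Rem. 2.4.1] -/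
theorem map_frobeniusOver_map_frobeniusOver_geomReductionMap_tensor_lift (𝒳 : IntegralModel (valuationSubringAtPrime K v) K X)
    (𝒴 : IntegralModel (valuationSubringAtPrime K v) K Y) [IsProper 𝒳.total.hom] [IsProper 𝒴.total.hom]
    (x₁ : AlgPoints X (AlgebraicClosure (v.adicCompletion K))) (x₂ : AlgPoints Y (AlgebraicClosure (v.adicCompletion K))) :
    AlgPoints.map (frobeniusOver ((specialFibreFunctor v).obj (𝒳.total ⊗ 𝒴.total)))
        (AlgPoints.map (frobeniusOver ((specialFibreFunctor v).obj (𝒳.total ⊗ 𝒴.total)))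
          (haveI := isProper_tensor_total 𝒳 𝒴; (𝒳.tensor 𝒴).geomReductionMap (lift x₁ x₂))) =
      lift (AlgPoints.map (frobeniusOver 𝒳.reductionAt) (AlgPoints.map (frobeniusOver 𝒳.reductionAt) (𝒳.geomReductionMap x₁)))
          (AlgPoints.map (frobeniusOver 𝒴.reductionAt) (AlgPoints.map (frobeniusOver 𝒴.reductionAt) (𝒴.geomReductionMap x₂))) ≫
        Functor.LaxMonoidal.μ (specialFibreFunctor v) 𝒳.total 𝒴.total :=
  iterate_map_frobeniusOver_geomReductionMap_tensor_lift 𝒳 𝒴 x₁ x₂ 2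

end Literature.AlgebraicGeometry.Motives.IntegralModel

end
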